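import Literature.Analysis.PDE.PatchLocalization
import Literature.Analysis.PDE.SobolevLeibnizSharp
import HarnessLib

/-!
# Lower-order terms of a chart expression re-localised into all patches: energy bounds
# (topic `Analysis/PDE`)

Analytic–geometric layer of the programme to prove short-time existence for quasilinear
strictly parabolic systems on a closed manifold (hypothesis `hQL` of
`Literature.Geometry.Riemannian.ricciFlow_shortTime_existence_of_quasilinear`). In the a priori
estimates of that programme (patch system `P`, cut-off own-chart expressions
`w_q = cutExpr P q f`), the terms of order `≤ 1` of the residual of a patch `p` are products
`θ(y) • f(κ_p⁻¹ y)` and `θ(y) • ∂_ξ(f ∘ κ_p⁻¹)(y)` with smooth multipliers `θ` supported in a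
compact subset of the target of `κ_p`. This file bounds their Sobolev energies by those of ALL
the `w_q` and their first frame derivatives, with constants independent of `f`:

* `contDiffOn_rhoIn_smul_cutExpr_transition` — the localised summands
  `ρ_q∘κ_p⁻¹ • (w_q ∘ τ_{pq})` are smooth on the target of `κ_p`;
* `fderiv_comp_inv_apply_eq_sum` — the derivative of `f ∘ κ_p⁻¹` through the localisation
  identity (product and chain rules): `θ ∂_ξ(f∘κ_p⁻¹) = Σ_q [θ ∂_ξ(ρ_q∘κ_p⁻¹) • w_q∘τ
  + Σ_m θ (ρ_q∘κ_p⁻¹) ⟪b_m, Dτ ξ⟫ • (∂_m w_q)∘τ]`;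
* `sobolevEnergy_smul_comp_inv_le` — `E_i(θ • f∘κ_p⁻¹) ≤ C Σ_q E_i(w_q)`;
* `sobolevEnergy_smul_fderiv_comp_inv_le` —
  `E_i(θ • ∂_ξ(f∘κ_p⁻¹)) ≤ C Σ_q (E_i(w_q) + Σ_m E_i(∂_m w_q))`.

Everything is proved; no named fact and no `sorry` is introduced.

## References

* J. M. Lee, *Introduction to Smooth Manifolds*, 2nd ed., Springer 2013, Thm. 2.23. [Lee2013]
* R. A. Adams, *Sobolev Spaces*, Academic Press 1975, Thm. 3.35. [Adams1975]
-/

noncomputable section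

open Set Function Filter Topology Metric MeasureTheory
open scoped Manifold ContDiff Topology ENNReal RealInnerProductSpace

namespace Literature.Analysis.PDE

open Literature.Geometry.Manifold

variable {E : Type*} [NormedAddCommGroup E] [NormedSpace ℝ E] {H : Type*} [TopologicalSpace H]
variable {I : ModelWithCorners ℝ E H} {M : Type*} [TopologicalSpace M] [ChartedSpace H M]
variable {E' : Type*} [NormedAddCommGroup E'] [InnerProductSpace ℝ E'] [FiniteDimensional ℝ E']
variable {F : Type*} [NormedAddCommGroup F] [NormedSpace ℝ F]
variable {ι : Type*} [Fintype ι] (P : PatchSystem I M E' ι)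

namespace PatchSystemLoc

variable [IsManifold I ∞ M] [I.Boundaryless] [T2Space M]

/-! ### The localised summands on the target of a patch -/

omit [IsManifold I ∞ M] [I.Boundaryless] in
/-- Where `ρ_q∘κ_p⁻¹` does not vanish identically near a point of the target, the point lies in
the overlap: the compact set `κ_q⁻¹ closedBall(2r_q)` contains `κ_p⁻¹ y` for every
`y ∈ target ∩ tsupport (ρ_q∘κ_p⁻¹)`. [folklore] -/
theorem inv_mem_of_mem_tsupport_rhoIn {p q : ι} {y : E'} (hy : y ∈ (P.chart p).target)
    (hyρ : y ∈ tsupport (rhoIn P p q)) :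
    (P.chart p).inv y ∈ (P.chart q).inv '' closedBall (0 : E') (2 * P.r q) := by
  obtain ⟨K, _, hKV, hsub⟩ := exists_compact_inter_tsupport_rhoIn_subset P
    (isCompact_singleton (x := y)) (singleton_subset_iff.2 hy) q
  have hyK : y ∈ K := hsub ⟨mem_singleton y, hyρ⟩
  obtain ⟨_, hys⟩ := ((P.chart p).mem_overlap_iff (P.chart q)).1 (hKV hyK)
  -- the point charts into the support ball by continuity (closure of the points with `ρ_q ≠ 0`)
  obtain ⟨hC2, _⟩ := (P.chart q).isCompact_image_inv (isCompact_closedBall (0 : E') (2 * P.r q))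
    (P.closedBall_subset_target q (by norm_num))
  have hsub' : (P.chart p).inv '' Function.support (rhoIn P p q) ⊆
      (P.chart q).inv '' closedBall (0 : E') (2 * P.r q) := by
    rintro x ⟨z, hz, rfl⟩
    obtain ⟨_, hzs, hzb⟩ := mem_of_rhoIn_ne_zero P hz
    exact ⟨(P.chart q).map ((P.chart p).inv z), ball_subset_closedBall hzb, (P.chart q).inv_map hzs⟩
  have hcont : ContinuousWithinAt (P.chart p).inv (Function.support (rhoIn P p q)) y :=
    ((P.chart p).continuousOn_inv y hy).mono fun z hz ↦ (mem_of_rhoIn_ne_zero P hz).1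
  have h := hcont.mem_closure_image hyρ
  rw [← hC2.isClosed.closure_eq]
  exact closure_mono hsub' h

omit [IsManifold I ∞ M] [I.Boundaryless] [T2Space M] in
/-- Off the closed support region, `ρ_q∘κ_p⁻¹` vanishes near the point. [folklore] -/
theorem rhoIn_eventuallyEq_zero {p q : ι} {y : E'} (hyρ : y ∉ tsupport (rhoIn P p q)) :
    rhoIn P p q =ᶠ[𝓝 y] fun _ ↦ 0 :=
  notMem_tsupport_iff_eventuallyEq.1 hyρ

/-- **The localised summands are smooth on the target**: `y ↦ ρ_q(κ_p⁻¹ y) • w_q(τ_{pq} y)` is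
smooth on the target of `κ_p` whenever `w_q = cutExpr P q f` is smooth. [cite: Lee2013, Thm. 2.23] -/
theorem contDiffOn_rhoIn_smul_cutExpr_transition (p q : ι) {f : M → F}
    (hfq : ContDiffOn ℝ ∞ (f ∘ (P.chart q).inv) (P.chart q).target) :
    ContDiffOn ℝ ∞ (fun y ↦ rhoIn P p q y • cutExpr P q f ((P.chart p).transition (P.chart q) y))
      (P.chart p).target := by
  have hw : ContDiff ℝ ∞ (cutExpr P q f) := contDiff_cutExpr P hfq
  intro y hy
  by_cases hyρ : y ∈ tsupport (rhoIn P p q)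
  · -- on the overlap: product of smooth functions
    have hys : (P.chart p).inv y ∈ (P.chart q).source :=
      ((P.chart q).isCompact_image_inv (isCompact_closedBall (0 : E') (2 * P.r q))
        (P.closedBall_subset_target q (by norm_num))).2 (inv_mem_of_mem_tsupport_rhoIn P hy hyρ)
    have hyo : y ∈ (P.chart p).overlap (P.chart q) := ((P.chart p).mem_overlap_iff (P.chart q)).2 ⟨hy, hys⟩
    have hO := (P.chart p).isOpen_overlap (P.chart q)
    have h1 : ContDiffOn ℝ ∞ (fun y ↦ rhoIn P p q y • cutExpr P q f ((P.chart p).transition (P.chart q) y))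
        ((P.chart p).overlap (P.chart q)) :=
      ((contDiffOn_rhoIn P p q).mono ((P.chart p).overlap_subset_target (P.chart q))).smul
        (hw.comp_contDiffOn ((P.chart p).contDiffOn_transition (P.chart q)))
    exact (h1.contDiffAt (hO.mem_nhds hyo)).contDiffWithinAt
  · -- off the support region the summand vanishes near `y`
    have hev : (fun y ↦ rhoIn P p q y • cutExpr P q f ((P.chart p).transition (P.chart q) y)) =ᶠ[𝓝 y]
        fun _ ↦ 0 := by
      filter_upwards [rhoIn_eventuallyEq_zero P hyρ] with z hz
      simp [hz]
    exact ((contDiffAt_const (c := (0 : F))).congr_of_eventuallyEq hev).contDiffWithinAt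

/-- The derivative of a localised summand (product and chain rules; off the support region both
sides vanish): for `y` in the target of `κ_p`,
`∂_ξ(ρ_q∘κ_p⁻¹ • w_q∘τ)(y) = ∂_ξ(ρ_q∘κ_p⁻¹)(y) • w_q(τ y) + ρ_q(κ_p⁻¹ y) • Dw_q(τ y)(Dτ(y) ξ)`.
[folklore] -/
theorem fderiv_rhoIn_smul_cutExpr_transition_apply (p q : ι) {f : M → F}
    (hfq : ContDiffOn ℝ ∞ (f ∘ (P.chart q).inv) (P.chart q).target) {y : E'}
    (hy : y ∈ (P.chart p).target) (ξ : E') :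
    fderiv ℝ (fun y ↦ rhoIn P p q y • cutExpr P q f ((P.chart p).transition (P.chart q) y)) y ξ =
      fderiv ℝ (rhoIn P p q) y ξ • cutExpr P q f ((P.chart p).transition (P.chart q) y) +
        rhoIn P p q y • fderiv ℝ (cutExpr P q f) ((P.chart p).transition (P.chart q) y)
          (fderiv ℝ ((P.chart p).transition (P.chart q)) y ξ) := by
  have hw : ContDiff ℝ ∞ (cutExpr P q f) := contDiff_cutExpr P hfq
  by_cases hyρ : y ∈ tsupport (rhoIn P p q)
  · have hys : (P.chart p).inv y ∈ (P.chart q).source :=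
      ((P.chart q).isCompact_image_inv (isCompact_closedBall (0 : E') (2 * P.r q))
        (P.closedBall_subset_target q (by norm_num))).2 (inv_mem_of_mem_tsupport_rhoIn P hy hyρ)
    have hyo : y ∈ (P.chart p).overlap (P.chart q) := ((P.chart p).mem_overlap_iff (P.chart q)).2 ⟨hy, hys⟩
    have hO := (P.chart p).isOpen_overlap (P.chart q)
    have hdρ : DifferentiableAt ℝ (rhoIn P p q) y :=
      ((contDiffOn_rhoIn P p q).differentiableOn (by simp) y hy).differentiableAt
        ((P.chart p).isOpen_target.mem_nhds hy)
    have hdτ : DifferentiableAt ℝ ((P.chart p).transition (P.chart q)) y :=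
      ((((P.chart p).contDiffOn_transition (P.chart q) (n := ∞)).differentiableOn (by simp)) y hyo).differentiableAt
        (hO.mem_nhds hyo)
    have hdw : DifferentiableAt ℝ (cutExpr P q f) ((P.chart p).transition (P.chart q) y) :=
      (hw.differentiable (by simp)) _
    have hcomp : DifferentiableAt ℝ (fun y ↦ cutExpr P q f ((P.chart p).transition (P.chart q) y)) y :=
      hdw.comp y hdτ
    rw [fderiv_fun_smul hdρ hcomp]
    simp only [add_apply, smul_apply, ContinuousLinearMap.smulRight_apply]
    rw [show (fun y ↦ cutExpr P q f ((P.chart p).transition (P.chart q) y)) =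
        cutExpr P q f ∘ (P.chart p).transition (P.chart q) from rfl, fderiv_comp y hdw hdτ]
    simp only [ContinuousLinearMap.comp_apply]
    rw [add_comm]
  · -- both sides vanish near `y`
    have hev := rhoIn_eventuallyEq_zero P hyρ
    have h0 : rhoIn P p q y = 0 := hev.self_of_nhds
    have h1 : fderiv ℝ (rhoIn P p q) y = 0 := by
      rw [hev.fderiv_eq]; simp
    have hev2 : (fun y ↦ rhoIn P p q y • cutExpr P q f ((P.chart p).transition (P.chart q) y)) =ᶠ[𝓝 y]
        fun _ ↦ 0 := by
      filter_upwards [hev] with z hz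
      simp [hz]
    rw [hev2.fderiv_eq, h0, h1]
    simp

/-- **The derivative of a chart expression through the localisation identity**: for `y` in the
target of `κ_p`, `∂_ξ(f∘κ_p⁻¹)(y) = Σ_q ∂_ξ(ρ_q∘κ_p⁻¹ • w_q∘τ_{pq})(y)`. [cite: Lee2013, Thm. 2.23] -/
theorem fderiv_comp_inv_apply_eq_sum (p : ι) {f : M → F}
    (hf : ∀ q, ContDiffOn ℝ ∞ (f ∘ (P.chart q).inv) (P.chart q).target) {y : E'}
    (hy : y ∈ (P.chart p).target) (ξ : E') :
    fderiv ℝ (f ∘ (P.chart p).inv) y ξ =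
      ∑ q, fderiv ℝ (fun y ↦ rhoIn P p q y • cutExpr P q f ((P.chart p).transition (P.chart q) y)) y ξ := by
  have hopen := (P.chart p).isOpen_target
  -- the localisation identity as an equality of functions near `y`
  have hev : (f ∘ (P.chart p).inv) =ᶠ[𝓝 y]
      fun y ↦ ∑ q, rhoIn P p q y • cutExpr P q f ((P.chart p).transition (P.chart q) y) := by
    filter_upwards [hopen.mem_nhds hy] with z hz
    exact localization_identity P f hz
  rw [hev.fderiv_eq]
  have hd : ∀ q, DifferentiableAt ℝ
      (fun y ↦ rhoIn P p q y • cutExpr P q f ((P.chart p).transition (P.chart q) y)) y := fun q ↦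
    ((contDiffOn_rhoIn_smul_cutExpr_transition P p q (hf q)).differentiableOn (by simp) y hy).differentiableAt
      (hopen.mem_nhds hy)
  rw [fderiv_fun_sum fun q _ ↦ hd q]
  simp

omit [IsManifold I ∞ M] [I.Boundaryless] [T2Space M] in
/-- Expansion of a derivative in the frame: `L ζ = Σ_m ⟪b_m, ζ⟫ L b_m`. [folklore] -/
theorem clm_apply_eq_sum_inner_smul (L : E' →L[ℝ] F) (ζ : E') :
    L ζ = ∑ m, ⟪stdOrthonormalBasis ℝ E' m, ζ⟫ • L (stdOrthonormalBasis ℝ E' m) := by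
  conv_lhs => rw [← (stdOrthonormalBasis ℝ E').sum_repr' ζ]
  rw [map_sum]
  refine Finset.sum_congr rfl fun m _ ↦ ?_
  rw [map_smul]

/-- **First-order localisation identity with a multiplier**: for every `y` (both sides vanish off
the target),
`θ(y) • ∂_ξ(f∘κ_p⁻¹)(y) = Σ_q [ (θ ∂_ξ(ρ_q∘κ_p⁻¹))(y) • w_q(τ y)
  + Σ_m (θ (ρ_q∘κ_p⁻¹) ⟪b_m, Dτ(y)ξ⟫)(y) • (∂_m w_q)(τ y) ]`. [cite: Lee2013, Thm. 2.23] -/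
theorem smul_fderiv_comp_inv_eq_sum (p : ι) {f : M → F}
    (hf : ∀ q, ContDiffOn ℝ ∞ (f ∘ (P.chart q).inv) (P.chart q).target) {θ : E' → ℝ}
    (hθt : tsupport θ ⊆ (P.chart p).target) (ξ : E') (y : E') :
    θ y • fderiv ℝ (f ∘ (P.chart p).inv) y ξ =
      ∑ q, ((θ y * fderiv ℝ (rhoIn P p q) y ξ) • cutExpr P q f ((P.chart p).transition (P.chart q) y) +
        ∑ m, (θ y * rhoIn P p q y *
            ⟪stdOrthonormalBasis ℝ E' m, fderiv ℝ ((P.chart p).transition (P.chart q)) y ξ⟫) •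
          fderiv ℝ (cutExpr P q f) ((P.chart p).transition (P.chart q) y) (stdOrthonormalBasis ℝ E' m)) := by
  by_cases hy : y ∈ (P.chart p).target
  · rw [fderiv_comp_inv_apply_eq_sum P p hf hy ξ, Finset.smul_sum]
    refine Finset.sum_congr rfl fun q _ ↦ ?_
    rw [fderiv_rhoIn_smul_cutExpr_transition_apply P p q (hf q) hy ξ, smul_add, smul_smul,
      clm_apply_eq_sum_inner_smul (fderiv ℝ (cutExpr P q f) ((P.chart p).transition (P.chart q) y))
        (fderiv ℝ ((P.chart p).transition (P.chart q)) y ξ)]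
    simp only [Finset.smul_sum, smul_smul, mul_assoc]
  · have h0 : θ y = 0 := image_eq_zero_of_notMem_tsupport fun h ↦ hy (hθt h)
    simp [h0]

omit [IsManifold I ∞ M] [I.Boundaryless] [T2Space M] in
/-- **Zeroth-order localisation identity with a multiplier**, valid everywhere:
`θ(y) • f(κ_p⁻¹ y) = Σ_q (θ · ρ_q∘κ_p⁻¹)(y) • w_q(τ y)`. [cite: Lee2013, Thm. 2.23] -/
theorem smul_comp_inv_eq_sum (p : ι) (f : M → F) {θ : E' → ℝ} (hθt : tsupport θ ⊆ (P.chart p).target)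
    (y : E') :
    θ y • f ((P.chart p).inv y) =
      ∑ q, (θ y * rhoIn P p q y) • cutExpr P q f ((P.chart p).transition (P.chart q) y) := by
  by_cases hy : y ∈ (P.chart p).target
  · exact localization_identity_smul P θ f hy
  · have h0 : θ y = 0 := image_eq_zero_of_notMem_tsupport fun h ↦ hy (hθt h)
    simp [h0]

/-! ### Energy bounds -/

section Energy

variable [MeasurableSpace E'] [BorelSpace E']

/-- **Zeroth-order terms**: for a smooth multiplier `θ` supported in a compact subset of the target
of `κ_p` and every order `i` there is `C < ∞` with `E_i(θ • f∘κ_p⁻¹) ≤ C Σ_q E_i(w_q)` for all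
`f` with smooth chart expressions. [cite: Adams1975, Thm. 3.35] -/
theorem sobolevEnergy_smul_comp_inv_le (p : ι) {θ : E' → ℝ} (hθ : ContDiff ℝ ∞ θ) {Cθ : Set E'}
    (hCθ : IsCompact Cθ) (hCθt : Cθ ⊆ (P.chart p).target) (hθC : tsupport θ ⊆ Cθ) (i : ℕ) :
    ∃ C : ℝ≥0∞, C ≠ ⊤ ∧ ∀ {f : M → F}, (∀ q, ContDiffOn ℝ ∞ (f ∘ (P.chart q).inv) (P.chart q).target) →
      sobolevEnergy i (fun y ↦ θ y • f ((P.chart p).inv y)) ≤ C * ∑ q, sobolevEnergy i (cutExpr P q f) := by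
  classical
  -- per-patch transport constants
  have hq : ∀ q, ∃ C : ℝ≥0∞, C ≠ ⊤ ∧ ∀ {g : E' → F}, ContDiff ℝ ∞ g →
      sobolevEnergy i (fun y ↦ (θ y * rhoIn P p q y) • g ((P.chart p).transition (P.chart q) y)) ≤
        C * sobolevEnergy i g := fun q ↦ sobolevEnergy_transport_le P hθ hCθ hCθt hθC q i
  choose C hCtop hC using hq
  refine ⟨(Fintype.card ι : ℝ≥0∞) * ∑ q, C q, ENNReal.mul_ne_top (ENNReal.natCast_ne_top _)
    (ENNReal.sum_ne_top.2 fun q _ ↦ hCtop q), fun {f} hf ↦ ?_⟩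
  have hw : ∀ q, ContDiff ℝ ∞ (cutExpr P q f) := fun q ↦ contDiff_cutExpr P (hf q)
  -- the summands are globally smooth
  have hsm : ∀ q, ContDiff ℝ ∞ fun y ↦ (θ y * rhoIn P p q y) •
      cutExpr P q f ((P.chart p).transition (P.chart q) y) := by
    intro q
    obtain ⟨K, hK, hKV, hsupp⟩ := exists_compact_multiplier_support P hCθ hCθt hθC q
    exact contDiff_smul_comp_of_tsupport_subset ((P.chart p).isOpen_overlap (P.chart q))
      ((P.chart p).contDiffOn_transition (P.chart q)) hKV (contDiff_mul_rhoIn P hθ (hθC.trans hCθt) q)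
      hsupp (hw q)
  have heq : (fun y ↦ θ y • f ((P.chart p).inv y)) = fun y ↦ ∑ q, (θ y * rhoIn P p q y) •
      cutExpr P q f ((P.chart p).transition (P.chart q) y) :=
    funext fun y ↦ smul_comp_inv_eq_sum P p f (hθC.trans hCθt) y
  rw [heq]
  calc sobolevEnergy i (fun y ↦ ∑ q, (θ y * rhoIn P p q y) •
        cutExpr P q f ((P.chart p).transition (P.chart q) y))
      ≤ (Finset.univ.card : ℝ≥0∞) * ∑ q, sobolevEnergy i (fun y ↦ (θ y * rhoIn P p q y) •
          cutExpr P q f ((P.chart p).transition (P.chart q) y)) :=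
        sobolevEnergy_sum_le_card i Finset.univ fun q _ ↦ (hsm q).of_le (by exact_mod_cast le_top)
    _ ≤ (Fintype.card ι : ℝ≥0∞) * ∑ q, C q * sobolevEnergy i (cutExpr P q f) := by
        rw [Finset.card_univ]
        exact mul_le_mul' le_rfl (Finset.sum_le_sum fun q _ ↦ hC q (hw q))
    _ ≤ (Fintype.card ι : ℝ≥0∞) * ∑ q, (∑ q', C q') * sobolevEnergy i (cutExpr P q f) := by
        refine mul_le_mul' le_rfl (Finset.sum_le_sum fun q _ ↦ mul_le_mul' ?_ le_rfl)
        exact Finset.single_le_sum (f := C) (fun _ _ ↦ bot_le) (Finset.mem_univ q)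
    _ = (Fintype.card ι : ℝ≥0∞) * (∑ q, C q) * ∑ q, sobolevEnergy i (cutExpr P q f) := by
        rw [← Finset.mul_sum, mul_assoc]

/-- **First-order terms**: for a smooth multiplier `θ` supported in a compact subset of the target
of `κ_p`, a direction `ξ` and every order `i` there is `C < ∞` with
`E_i(θ • ∂_ξ(f∘κ_p⁻¹)) ≤ C Σ_q (E_i(w_q) + Σ_m E_i(∂_m w_q))` for all `f` with smooth chart
expressions. [cite: Adams1975, Thm. 3.35] -/
theorem sobolevEnergy_smul_fderiv_comp_inv_le (p : ι) {θ : E' → ℝ} (hθ : ContDiff ℝ ∞ θ)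
    {Cθ : Set E'} (hCθ : IsCompact Cθ) (hCθt : Cθ ⊆ (P.chart p).target) (hθC : tsupport θ ⊆ Cθ)
    (ξ : E') (i : ℕ) :
    ∃ C : ℝ≥0∞, C ≠ ⊤ ∧ ∀ {f : M → F}, (∀ q, ContDiffOn ℝ ∞ (f ∘ (P.chart q).inv) (P.chart q).target) →
      sobolevEnergy i (fun y ↦ θ y • fderiv ℝ (f ∘ (P.chart p).inv) y ξ) ≤
        C * ∑ q, (sobolevEnergy i (cutExpr P q f) +
          ∑ m, sobolevEnergy i (fun y ↦ fderiv ℝ (cutExpr P q f) y (stdOrthonormalBasis ℝ E' m))) := by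
  classical
  set b := stdOrthonormalBasis ℝ E'
  have hθt : tsupport θ ⊆ (P.chart p).target := hθC.trans hCθt
  -- the compact multiplier supports inside the overlaps
  have hK : ∀ q, ∃ K : Set E', IsCompact K ∧ K ⊆ (P.chart p).overlap (P.chart q) ∧
      Cθ ∩ tsupport (rhoIn P p q) ⊆ K := fun q ↦ exists_compact_inter_tsupport_rhoIn_subset P hCθ hCθt q
  choose K hKc hKV hKsub using hK
  -- the two kinds of multipliers are smooth with support in `K q`
  set m₁ : ι → E' → ℝ := fun q y ↦ θ y * fderiv ℝ (rhoIn P p q) y ξ with hm₁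
  set m₂ : ι → Fin (Module.finrank ℝ E') → E' → ℝ := fun q m y ↦
    θ y * rhoIn P p q y * ⟪b m, fderiv ℝ ((P.chart p).transition (P.chart q)) y ξ⟫ with hm₂
  have hm₁s : ∀ q, ContDiff ℝ ∞ (m₁ q) := by
    intro q
    have h := contDiff_smul_of_tsupport_subset (P.chart p).isOpen_target hθ hθt
      (contDiffOn_fderiv_apply_of_isOpen (P.chart p).isOpen_target (contDiffOn_rhoIn P p q) ξ)
    simpa only [smul_eq_mul] using h
  have hm₁K : ∀ q, tsupport (m₁ q) ⊆ K q := by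
    intro q y hy
    refine hKsub q ⟨hθC (tsupport_mul_subset_left hy), ?_⟩
    exact tsupport_fderiv_apply_subset ℝ ξ (tsupport_mul_subset_right hy)
  have hm₂s : ∀ q m, ContDiff ℝ ∞ (m₂ q m) := by
    intro q m
    obtain ⟨K', hK', hK'V, hsupp⟩ := exists_compact_multiplier_support P hCθ hCθt hθC q
    have hc : ContDiffOn ℝ ∞ (fun y ↦ ⟪b m, fderiv ℝ ((P.chart p).transition (P.chart q)) y ξ⟫)
        ((P.chart p).overlap (P.chart q)) :=
      contDiffOn_const.inner ℝ (contDiffOn_fderiv_apply_of_isOpen ((P.chart p).isOpen_overlap (P.chart q))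
        ((P.chart p).contDiffOn_transition (P.chart q)) ξ)
    have h := contDiff_smul_of_tsupport_subset ((P.chart p).isOpen_overlap (P.chart q))
      (contDiff_mul_rhoIn P hθ hθt q) (hsupp.trans hK'V) hc
    simpa only [smul_eq_mul] using h
  have hm₂K : ∀ q m, tsupport (m₂ q m) ⊆ K q := by
    intro q m y hy
    have hy' : y ∈ tsupport (fun y ↦ θ y * rhoIn P p q y) := tsupport_mul_subset_left hy
    exact hKsub q ⟨hθC (tsupport_mul_subset_left hy'), tsupport_mul_subset_right hy'⟩
  -- transport constants
  have h1 : ∀ q, ∃ C : ℝ≥0∞, C ≠ ⊤ ∧ ∀ {g : E' → F}, ContDiff ℝ ∞ g →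
      sobolevEnergy i (fun y ↦ m₁ q y • g ((P.chart p).transition (P.chart q) y)) ≤ C * sobolevEnergy i g :=
    fun q ↦ sobolevEnergy_smul_comp_transition_le P q (hm₁s q) (hKc q) (hKV q) (hm₁K q) i
  have h2 : ∀ q m, ∃ C : ℝ≥0∞, C ≠ ⊤ ∧ ∀ {g : E' → F}, ContDiff ℝ ∞ g →
      sobolevEnergy i (fun y ↦ m₂ q m y • g ((P.chart p).transition (P.chart q) y)) ≤ C * sobolevEnergy i g :=
    fun q m ↦ sobolevEnergy_smul_comp_transition_le P q (hm₂s q m) (hKc q) (hKV q) (hm₂K q m) i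
  choose C₁ hC₁top hC₁ using h1
  choose C₂ hC₂top hC₂ using h2
  -- the total constant
  set N : ℝ≥0∞ := ((Fintype.card ι * (1 + Module.finrank ℝ E') : ℕ) : ℝ≥0∞) with hN
  set Ctot : ℝ≥0∞ := N * N * ((∑ q, C₁ q) + ∑ q, ∑ m, C₂ q m) with hCtot
  have hCtot_top : Ctot ≠ ⊤ := ENNReal.mul_ne_top
    (ENNReal.mul_ne_top (ENNReal.natCast_ne_top _) (ENNReal.natCast_ne_top _))
    (ENNReal.add_ne_top.2 ⟨ENNReal.sum_ne_top.2 fun q _ ↦ hC₁top q,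
      ENNReal.sum_ne_top.2 fun q _ ↦ ENNReal.sum_ne_top.2 fun m _ ↦ hC₂top q m⟩)
  refine ⟨Ctot, hCtot_top, fun {f} hf ↦ ?_⟩
  have hw : ∀ q, ContDiff ℝ ∞ (cutExpr P q f) := fun q ↦ contDiff_cutExpr P (hf q)
  have hwm : ∀ q m, ContDiff ℝ ∞ fun y ↦ fderiv ℝ (cutExpr P q f) y (b m) := fun q m ↦
    ((hw q).fderiv_right (m := ∞) (by norm_cast)).clm_apply contDiff_const
  -- rewrite as a sum over the index set `ι × Option (Fin n)` of transported terms
  set term : ι × Option (Fin (Module.finrank ℝ E')) → E' → F := fun qm y ↦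
    match qm.2 with
    | none => m₁ qm.1 y • cutExpr P qm.1 f ((P.chart p).transition (P.chart qm.1) y)
    | some m => m₂ qm.1 m y •
        fderiv ℝ (cutExpr P qm.1 f) ((P.chart p).transition (P.chart qm.1) y) (b m) with hterm
  have heq : (fun y ↦ θ y • fderiv ℝ (f ∘ (P.chart p).inv) y ξ) = fun y ↦ ∑ qm, term qm y := by
    funext y
    rw [smul_fderiv_comp_inv_eq_sum P p hf hθt ξ y, Fintype.sum_prod_type]
    refine Finset.sum_congr rfl fun q _ ↦ ?_
    rw [Fintype.sum_option]
  have hsm : ∀ qm, ContDiff ℝ ∞ (term qm) := by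
    rintro ⟨q, _ | m⟩
    · exact contDiff_smul_comp_of_tsupport_subset ((P.chart p).isOpen_overlap (P.chart q))
        ((P.chart p).contDiffOn_transition (P.chart q)) (hKV q) (hm₁s q) (hm₁K q) (hw q)
    · exact contDiff_smul_comp_of_tsupport_subset ((P.chart p).isOpen_overlap (P.chart q))
        ((P.chart p).contDiffOn_transition (P.chart q)) (hKV q) (hm₂s q m) (hm₂K q m) (hwm q m)
  have hbd : ∀ qm, sobolevEnergy i (term qm) ≤ ((∑ q, C₁ q) + ∑ q, ∑ m, C₂ q m) *
      ∑ q, (sobolevEnergy i (cutExpr P q f) + ∑ m, sobolevEnergy i (fun y ↦ fderiv ℝ (cutExpr P q f) y (b m))) := by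
    rintro ⟨q, _ | m⟩
    · calc sobolevEnergy i (term (q, none)) ≤ C₁ q * sobolevEnergy i (cutExpr P q f) := hC₁ q (hw q)
        _ ≤ ((∑ q, C₁ q) + ∑ q, ∑ m, C₂ q m) * ∑ q, (sobolevEnergy i (cutExpr P q f) +
            ∑ m, sobolevEnergy i (fun y ↦ fderiv ℝ (cutExpr P q f) y (b m))) := by
          refine mul_le_mul' ?_ ?_
          · exact (Finset.single_le_sum (f := C₁) (fun _ _ ↦ bot_le) (Finset.mem_univ q)).trans le_self_add
          · exact (le_self_add (a := sobolevEnergy i (cutExpr P q f))).trans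
              (Finset.single_le_sum (f := fun q ↦ sobolevEnergy i (cutExpr P q f) +
                ∑ m, sobolevEnergy i (fun y ↦ fderiv ℝ (cutExpr P q f) y (b m)))
                (fun _ _ ↦ bot_le) (Finset.mem_univ q))
    · calc sobolevEnergy i (term (q, some m))
          ≤ C₂ q m * sobolevEnergy i (fun y ↦ fderiv ℝ (cutExpr P q f) y (b m)) := hC₂ q m (hwm q m)
        _ ≤ ((∑ q, C₁ q) + ∑ q, ∑ m, C₂ q m) * ∑ q, (sobolevEnergy i (cutExpr P q f) +
            ∑ m, sobolevEnergy i (fun y ↦ fderiv ℝ (cutExpr P q f) y (b m))) := by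
          refine mul_le_mul' ?_ ?_
          · refine le_add_left ?_
            refine le_trans ?_ (Finset.single_le_sum (f := fun q ↦ ∑ m, C₂ q m) (fun _ _ ↦ bot_le)
              (Finset.mem_univ q))
            exact Finset.single_le_sum (f := C₂ q) (fun _ _ ↦ bot_le) (Finset.mem_univ m)
          · refine le_trans ?_ (Finset.single_le_sum (f := fun q ↦ sobolevEnergy i (cutExpr P q f) +
                ∑ m, sobolevEnergy i (fun y ↦ fderiv ℝ (cutExpr P q f) y (b m)))
                (fun _ _ ↦ bot_le) (Finset.mem_univ q))
            exact le_add_left (Finset.single_le_sum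
              (f := fun m ↦ sobolevEnergy i (fun y ↦ fderiv ℝ (cutExpr P q f) y (b m)))
              (fun _ _ ↦ bot_le) (Finset.mem_univ m))
  rw [heq]
  have hcard : ((Finset.univ : Finset (ι × Option (Fin (Module.finrank ℝ E')))).card : ℝ≥0∞) = N := by
    rw [hN, Finset.card_univ, Fintype.card_prod, Fintype.card_option, Fintype.card_fin, Nat.add_comm]
  set T : ℝ≥0∞ := ∑ q, (sobolevEnergy i (cutExpr P q f) +
    ∑ m, sobolevEnergy i (fun y ↦ fderiv ℝ (cutExpr P q f) y (b m))) with hT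
  calc sobolevEnergy i (fun y ↦ ∑ qm, term qm y)
      ≤ ((Finset.univ : Finset (ι × Option (Fin (Module.finrank ℝ E')))).card : ℝ≥0∞) *
          ∑ qm, sobolevEnergy i (term qm) :=
        sobolevEnergy_sum_le_card i Finset.univ fun qm _ ↦ (hsm qm).of_le (by exact_mod_cast le_top)
    _ ≤ N * ∑ _qm : ι × Option (Fin (Module.finrank ℝ E')), ((∑ q, C₁ q) + ∑ q, ∑ m, C₂ q m) * T := by
        rw [hcard]
        exact mul_le_mul' le_rfl (Finset.sum_le_sum fun qm _ ↦ hbd qm)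
    _ = N * (((Finset.univ : Finset (ι × Option (Fin (Module.finrank ℝ E')))).card : ℝ≥0∞) *
          (((∑ q, C₁ q) + ∑ q, ∑ m, C₂ q m) * T)) := by
        rw [Finset.sum_const, nsmul_eq_mul]
    _ = Ctot * T := by
        rw [hcard, hCtot]
        ring

end Energy

end PatchSystemLoc

end Literature.Analysis.PDE

end
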